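/-
Copyright (c) 2026 the pub-hodgecm-mathlib formalisation cell (harness21).  Prover seat hodgecm-mathlib-K2Liu-p13 (g3), Track B «K2-LIT»,
#184♮ = hLiu418 = `stmt-HodgeConjecture-24832`; ROAD Φ (RULING «M-156n»), consumer sheet fa2b1e3a29709f09 row G6-fin — the binder `hBc` of
★ `K2LiuBigCellPackageOfFaces.exists_bigCell_package` (continuity of the CONVERGENT big cell in the group variable), LEAD F0P6-plan (g14) BATCH #30 ∕ #32 (2).
THEOREMS ONLY (no `def`, no `instance`, no named-fact hypothesis, no `sorry`).
-/
import Summits.HodgeConjecture.HodgeConjecture.Theorems.K2LiuConstantTermDelta                 -- ★ O41.4: `integral_wt_smul_tsum_weylDelta_orbit`, `apply_out_mk_wq_mul`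
import Summits.HodgeConjecture.HodgeConjecture.Theorems.K2LiuSiegelEisensteinContinuous        -- ★ G8 (pattern) + ★ `exists_summable_majorant_on_compact'`
import Summits.HodgeConjecture.HodgeConjecture.Theorems.K2LiuIntertwiningConverges             -- ★ O41.3 `intertwiningConverges`
import Summits.HodgeConjecture.HodgeConjecture.Theorems.K2LiuIntertwiningConvergesOfParabolic  -- ★ `exists_wq`
import Summits.HodgeConjecture.HodgeConjecture.Theorems.K2LiuUnipotentCocompact                -- ★ (C0) `exists_isCompact_cover_unipDelta`
import HarnessLib

/-!
# Crux `HLiu418`, ROAD Φ, organ Φ8 (sheet row G6-fin): THE CONVERGENT BIG CELL `h ↦ M(s)f_s(h) = ∫_{N_Δ(𝔸)} f_s(w_Δ u h) du` IS CONTINUOUS ON `H(𝔸)`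
# (`χ` unitary, `Re s > n∕2`, `f_s ∈ I(s, χ)` continuous) — the binder `hBc` of ★ `exists_bigCell_package`

Cell `hodgecm-mathlib`, crux item hLiu418 = `stmt-HodgeConjecture-24832` (helper lane, count-neutral).  The Vitali route of ★ `K2LiuBigCellPackageOfFaces.exists_bigCell_package`
(clause (ii) of the big-cell term package) needs the continuity of `h ↦ intertwiningDelta νN (f s) h` on the convergence half-plane only.  PROOF (dominated convergence in
covering-weight currency, the pattern of ★ G8 `K2LiuSiegelEisensteinContinuous` and of ★ F9 `K2LiuKlingenInnerSectionContinuous`):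
* §1 `continuous_tsum_weylDelta_orbit` — the big-cell orbit series `x ↦ Σ'_{ν ∈ N_Δ(L⁺)} f(w_Δ ν x)` is continuous: it is a sub-series of the Eisenstein series
  (★ `apply_out_mk_wq_mul`, ★ `mk_wq_injective`), so ★ `exists_summable_majorant_on_compact'` is a Weierstrass majorant on every compact set;
* §2 `continuous_integral_wt_smul_tsum_weylDelta_orbit` — for a weight `β ≤ 1_K`, `K ⊆ N_Δ(𝔸)` compact, `h ↦ ∫ β(u)·Σ'_ν f(w_Δ ν u h) dνN(u)` is continuous
  (Mathlib `continuousAt_of_dominated`: the integrand is continuous in `h` and bounded by `1_K · sup_{K·C}` on a compact neighbourhood `C`);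
* §3 **`continuous_intertwiningDelta`** — with the `N_Δ(L⁺)`-covering weight of ★ `exists_isCoveringWeight_unipDeltaRat_lintegral_ne_top` on the cocompact cover ★ (C0)
  `exists_isCompact_cover_unipDelta`, the weighted orbit integral IS `M(s)f_s(h)` for every `h` (★ O41.4 `integral_wt_smul_tsum_weylDelta_orbit`, absolute
  convergence ★ O41.3 `intertwiningConverges`), whence **`h ↦ intertwiningDelta νN f h` is continuous**; `continuous_intertwiningDelta_family` is the binder `hBc`
  of ★ `exists_bigCell_package` VERBATIM (`∀ s, n∕2 < re s → Continuous (fun h => intertwiningDelta νN (f s) h)`).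
Sources: [MoeglinWaldspurger1995, II.1.5–II.1.7]; [Garrett2018, §3.10]; [Folland1995, §2.3 (dominated convergence)].
HONEST LABEL.  Helper lemmas, count-neutral; `HC_CM` is proved only modulo the 7 printed citations (2 remaining named inputs:
hLiu418 = `stmt-HodgeConjecture-24832`, h413 = `stmt-HodgeConjecture-24833`) until rung 0 closes.
-/

set_option autoImplicit false
set_option linter.dupNamespace false -- the mandated namespace repeats `HodgeConjecture.HodgeConjecture`

noncomputable section

open scoped Matrix ENNReal NNReal Topology
open NumberField IsDedekindDomain MeasureTheory MeasureTheory.Measure Filter Set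

namespace Summit.HodgeConjecture.HodgeConjecture.Cruxes.HLiu418.K2LiuBigCellContinuous

open Literature.NumberTheory.Automorphic Literature.NumberTheory.Automorphic.UnitaryGroup Literature.NumberTheory.GaloisRepresentations
open Literature.NumberTheory.GelbartRogawski1991 Literature.NumberTheory.GelbartRogawski1991.GRConstruction
open Literature.NumberTheory.K2Lit.SiegelDoubled Literature.MeasureTheory.Group
open Summit.HodgeConjecture.HodgeConjecture.Cruxes.HLiu418.K2LiuSiegelEisensteinMajorantCompact
open Summit.HodgeConjecture.HodgeConjecture.Cruxes.HLiu418.K2LiuConstantTermBigCellUnfold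
open Summit.HodgeConjecture.HodgeConjecture.Cruxes.HLiu418.K2LiuConstantTermDelta
open Summit.HodgeConjecture.HodgeConjecture.Cruxes.HLiu418.K2LiuIntertwiningConverges
open Summit.HodgeConjecture.HodgeConjecture.Cruxes.HLiu418.K2LiuIntertwiningConvergesOfParabolic (exists_wq)
open Summit.HodgeConjecture.HodgeConjecture.Cruxes.HLiu418.K2LiuUnipotentCocompact (exists_isCompact_cover_unipDelta)
open Summit.HodgeConjecture.HodgeConjecture.Cruxes.HLiu418.K2LiuUnipotentCoveringWeight (exists_isCoveringWeight_unipDeltaRat_lintegral_ne_top)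

variable (L : Type) [Field L] [NumberField L] [IsCMField L]
variable {N M n : ℕ} (e : Fin N × Fin M ≃ Fin n)
  (dV : Fin N → L) (hdV : ∀ i, IsCMField.complexConj L (dV i) = dV i) (hdV0 : ∀ i, dV i ≠ 0)
  (dW : Fin M → L) (hdW : ∀ i, IsCMField.complexConj L (dW i) = dW i) (hdW0 : ∀ i, dW i ≠ 0)

/-! ## §1 The big-cell orbit series is continuous -/

include hdV0 hdW0 in
/-- **THE BIG-CELL ORBIT SERIES `x ↦ Σ'_{ν ∈ N_Δ(L⁺)} f(w_Δ ν x)` IS CONTINUOUS** (`χ` unitary, `Re s > n∕2`, `f ∈ I(s, χ)` continuous): a sub-series of the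
Eisenstein series (★ `apply_out_mk_wq_mul`, ★ `mk_wq_injective`) with the `M`-test majorant ★ `exists_summable_majorant_on_compact'` on compact neighbourhoods.
[cite: MoeglinWaldspurger1995, II.1.5] [cite: Garrett2018, §3.10] -/
theorem continuous_tsum_weylDelta_orbit {χ : HeckeCharacter L} (hχ : χ.IsUnitary) {s : ℂ} (hs : (n : ℝ) / 2 < s.re)
    {f : HA L e dV hdV dW hdW → ℂ} (hf : IsSiegelDeltaSection L e dV hdV dW hdW χ s f) (hfc : Continuous f) :
    Continuous fun x : HA L e dV hdV dW hdW => ∑' ν : unipDeltaRat L e dV hdV dW hdW,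
      f (weylDelta L e dV hdV dW hdW * ((ν : unipDelta L e dV hdV dW hdW) : HA L e dV hdV dW hdW) * x) := by
  obtain ⟨wq, hwq⟩ := exists_wq L e dV hdV dW hdW
  refine continuous_iff_continuousAt.2 fun x₀ => ?_
  obtain ⟨K', hK'c, hK'n⟩ := exists_compact_mem_nhds x₀
  obtain ⟨u, hu, hb⟩ := exists_summable_majorant_on_compact' L e dV hdV hdV0 dW hdW hdW0 hχ hs hf hfc hK'c
  have hinj := mk_wq_injective (L := L) (e := e) (dV := dV) (hdV := hdV) (dW := dW) (hdW := hdW) wq hwq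
  have hterm : ∀ ν : unipDeltaRat L e dV hdV dW hdW,
      ContinuousOn (fun x : HA L e dV hdV dW hdW =>
        f (weylDelta L e dV hdV dW hdW * ((ν : unipDelta L e dV hdV dW hdW) : HA L e dV hdV dW hdW) * x)) K' := fun ν =>
    (hfc.comp (continuous_const.mul continuous_id)).continuousOn
  have hOn : ContinuousOn (fun x : HA L e dV hdV dW hdW => ∑' ν : unipDeltaRat L e dV hdV dW hdW,
      f (weylDelta L e dV hdV dW hdW * ((ν : unipDelta L e dV hdV dW hdW) : HA L e dV hdV dW hdW) * x)) K' := by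
    refine continuousOn_tsum hterm (hu.comp_injective hinj) fun ν x hx => ?_
    have h := hb x hx (Quotient.mk (MulAction.orbitRel (siegelDeltaRat L e dV hdV dW hdW) (ratH L e dV hdV dW hdW)) (wq ν))
    rwa [apply_out_mk_wq_mul wq hwq hf ν x] at h
  exact hOn.continuousAt hK'n

/-! ## §2 The weighted orbit integral is continuous in the group variable -/

include hdV0 hdW0 in
/-- **`h ↦ ∫ β(u) · Σ'_ν f(w_Δ ν u h) dνN(u)` IS CONTINUOUS** for a measurable weight `β ≤ 1_K` supported in a compact `K ⊆ N_Δ(𝔸)` and a measure `νN` finite on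
compacts (dominated convergence: the integrand is continuous in `h`, and on a compact neighbourhood `C` of `h₀` it is bounded by `1_K · sup_{K·C} |Σ'|`).
[cite: MoeglinWaldspurger1995, II.1.7] [cite: Folland1995, §2.3] -/
theorem continuous_integral_wt_smul_tsum_weylDelta_orbit
    [MeasurableSpace (unipDelta L e dV hdV dW hdW)] [BorelSpace (unipDelta L e dV hdV dW hdW)]
    (νN : Measure (unipDelta L e dV hdV dW hdW)) [IsFiniteMeasureOnCompacts νN]
    {χ : HeckeCharacter L} (hχ : χ.IsUnitary) {s : ℂ} (hs : (n : ℝ) / 2 < s.re)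
    {f : HA L e dV hdV dW hdW → ℂ} (hf : IsSiegelDeltaSection L e dV hdV dW hdW χ s f) (hfc : Continuous f)
    {β : unipDelta L e dV hdV dW hdW → ℝ≥0∞} (hβm : Measurable β) {K : Set (unipDelta L e dV hdV dW hdW)} (hK : IsCompact K)
    (hβK : ∀ u, β u ≤ K.indicator 1 u) :
    Continuous fun h : HA L e dV hdV dW hdW => ∫ u, (β u).toReal • (∑' ν : unipDeltaRat L e dV hdV dW hdW,
      f (weylDelta L e dV hdV dW hdW * ((ν : unipDelta L e dV hdV dW hdW) : HA L e dV hdV dW hdW) * ((u : HA L e dV hdV dW hdW) * h))) ∂νN := by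
  -- the orbit series as a continuous function `S` on `H(𝔸)`
  set S : HA L e dV hdV dW hdW → ℂ := fun x => ∑' ν : unipDeltaRat L e dV hdV dW hdW,
    f (weylDelta L e dV hdV dW hdW * ((ν : unipDelta L e dV hdV dW hdW) : HA L e dV hdV dW hdW) * x) with hSdef
  have hS : Continuous S := continuous_tsum_weylDelta_orbit L e dV hdV hdV0 dW hdW hdW0 hχ hs hf hfc
  -- `β u ≤ 1` everywhere, `β u = 0` off `K`
  have hβle : ∀ u, (β u).toReal ≤ 1 := fun u => by
    have h1 : β u ≤ 1 := (hβK u).trans (Set.indicator_le_self' (fun _ _ => zero_le_one) u)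
    simpa using ENNReal.toReal_mono ENNReal.one_ne_top h1
  have hβ0 : ∀ u, u ∉ K → β u = 0 := fun u hu => by
    have h := hβK u
    rw [Set.indicator_of_notMem hu] at h
    exact le_antisymm h bot_le
  refine continuous_iff_continuousAt.2 fun h₀ => ?_
  obtain ⟨C, hCc, hCn⟩ := exists_compact_mem_nhds h₀
  -- a bound of `S` on the compact `K · C`
  have hD : IsCompact ((fun p : unipDelta L e dV hdV dW hdW × HA L e dV hdV dW hdW => (p.1 : HA L e dV hdV dW hdW) * p.2) '' (K ×ˢ C)) :=
    (hK.prod hCc).image (continuous_subtype_val.fst'.mul continuous_snd)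
  obtain ⟨Mc, hMc⟩ := hD.exists_bound_of_continuousOn hS.continuousOn
  refine continuousAt_of_dominated (bound := fun u => K.indicator (fun _ => Mc) u) ?_ ?_ ?_ ?_
  · -- measurability, for every `h`
    exact Eventually.of_forall fun h =>
      (hβm.ennreal_toReal.smul (hS.comp (continuous_subtype_val.mul continuous_const)).measurable).aestronglyMeasurable
  · -- domination on the neighbourhood `C`
    filter_upwards [hCn] with h hh
    refine Eventually.of_forall fun u => ?_
    by_cases hu : u ∈ K
    · rw [Set.indicator_of_mem hu, norm_smul, Real.norm_of_nonneg ENNReal.toReal_nonneg]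
      calc (β u).toReal * ‖S ((u : HA L e dV hdV dW hdW) * h)‖ ≤ 1 * Mc :=
            mul_le_mul (hβle u) (hMc _ ⟨(u, h), ⟨hu, hh⟩, rfl⟩) (norm_nonneg _) zero_le_one
        _ = Mc := one_mul _
    · rw [Set.indicator_of_notMem hu, hβ0 u hu, ENNReal.toReal_zero, zero_smul, norm_zero]
  · -- the bound is integrable: a constant on a compact set
    rw [integrable_indicator_iff hK.measurableSet]
    exact integrableOn_const (hK.measure_lt_top).ne
  · -- continuity of the integrand in `h`
    refine Eventually.of_forall fun u => ?_
    have hSu : Continuous fun x : HA L e dV hdV dW hdW => S ((u : HA L e dV hdV dW hdW) * x) :=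
      hS.comp (continuous_const.mul continuous_id)
    exact (hSu.const_smul ((β u).toReal)).continuousAt

/-! ## §3 The convergent big cell is continuous -/

include hdV0 hdW0 in
/-- **THE CONVERGENT BIG CELL IS CONTINUOUS**: for `χ` unitary, `Re s > n∕2`, a continuous Siegel section `f ∈ I(s, χ)` and a Haar measure `νN` on `N_Δ(𝔸)`,
`h ↦ M(s)f(h) = intertwiningDelta νN f h` is continuous on `H(𝔸)` (covering weight on the cocompact lattice `N_Δ(L⁺)`, ★ (C0); the weighted orbit integral equals
`M(s)f(h)` for every `h`, ★ O41.4, ★ O41.3; §2). [cite: MoeglinWaldspurger1995, II.1.6–II.1.7] [cite: Garrett2018, §3.10] -/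
theorem continuous_intertwiningDelta
    [MeasurableSpace (unipDelta L e dV hdV dW hdW)] [BorelSpace (unipDelta L e dV hdV dW hdW)]
    (νN : Measure (unipDelta L e dV hdV dW hdW)) [νN.IsHaarMeasure]
    {χ : HeckeCharacter L} (hχ : χ.IsUnitary) {s : ℂ} (hs : (n : ℝ) / 2 < s.re)
    {f : HA L e dV hdV dW hdW → ℂ} (hf : IsSiegelDeltaSection L e dV hdV dW hdW χ s f) (hfc : Continuous f) :
    Continuous fun h : HA L e dV hdV dW hdW => intertwiningDelta L e dV hdV dW hdW νN f h := by
  obtain ⟨K, hK, hcover⟩ := exists_isCompact_cover_unipDelta L e dV hdV dW hdW hdV0 hdW0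
  obtain ⟨β, hβ, -, hβK, -⟩ := exists_isCoveringWeight_unipDeltaRat_lintegral_ne_top L e dV hdV dW hdW νN hK hcover
  have hG := continuous_integral_wt_smul_tsum_weylDelta_orbit L e dV hdV hdV0 dW hdW hdW0 νN hχ hs hf hfc hβ.measurable hK hβK
  refine hG.congr fun h => ?_
  have hint : ∫⁻ u, ‖f (weylDelta L e dV hdV dW hdW * (u : HA L e dV hdV dW hdW) * h)‖ₑ ∂νN ≠ ∞ :=
    (intertwiningConverges L e dV hdV hdV0 dW hdW hdW0 χ hχ s hs f hf hfc νN h).hasFiniteIntegral.ne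
  exact integral_wt_smul_tsum_weylDelta_orbit νN hβ hfc h hint

include hdV0 hdW0 in
/-- **THE BINDER `hBc` OF ★ `K2LiuBigCellPackageOfFaces.exists_bigCell_package`, VERBATIM** (`c := n∕2`, `BIG s h := intertwiningDelta νN (f s) h`): for a family of
continuous Siegel sections `f s ∈ I(s, χ)`, `χ` unitary, `h ↦ M(s)(f s)(h)` is continuous for every `n∕2 < re s`. [cite: MoeglinWaldspurger1995, II.1.6–II.1.7] -/
theorem continuous_intertwiningDelta_family
    [MeasurableSpace (unipDelta L e dV hdV dW hdW)] [BorelSpace (unipDelta L e dV hdV dW hdW)]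
    (νN : Measure (unipDelta L e dV hdV dW hdW)) [νN.IsHaarMeasure]
    {χ : HeckeCharacter L} (hχ : χ.IsUnitary) (f : ℂ → HA L e dV hdV dW hdW → ℂ)
    (hf : ∀ s, IsSiegelDeltaSection L e dV hdV dW hdW χ s (f s)) (hfc : ∀ s, Continuous (f s)) :
    ∀ s : ℂ, (n : ℝ) / 2 < s.re → Continuous fun h : HA L e dV hdV dW hdW => intertwiningDelta L e dV hdV dW hdW νN (f s) h :=
  fun s hs => continuous_intertwiningDelta L e dV hdV hdV0 dW hdW hdW0 νN hχ hs (hf s) (hfc s)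

end Summit.HodgeConjecture.HodgeConjecture.Cruxes.HLiu418.K2LiuBigCellContinuous

end
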